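import Literature.NumberTheory.Sieve.DrappeauTypeIReductionBound
import Literature.NumberTheory.Sieve.DrappeauTypeISmoothParts
import HarnessLib

/-!
# Drappeau's Type I sums, the core estimate I: one good index tuple

Topic `Literature/NumberTheory/Sieve`; theorems only (plus the bookkeeping definition `coreTerm`), everything
PROVED.  Continuation of `DrappeauTypeIReductionBound` (the Type I bound `typeI_uR_bound` for SORTED scales and
UNIT classes) and `DrappeauTypeISmoothParts` (splitting `nᵢ = hᵢ nᵢ'`, `hᵢ ∣ L^∞`, `nᵢ' ≡ tᵢ (L)` a unit):
for one index tuple `p = (hᵢ, tᵢ)ᵢ` with all `hᵢ ≤ G₀` ("good"), the variables `nᵢ' ∈ subBox Vᵢ L (hᵢ, tᵢ)` are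
sorted by the reduced scales `Vᵢ/hᵢ` (a permutation of the coordinates, `TupleSums.sum_piFinset_perm`), the
largest becomes the "last" variable (`TupleSums.sum_piFinset_succ_last`), and `typeI_uR_bound` applies with
`ν' = ν ∏ hᵢ`; the outcome is uniform in `p` (`good_tuple_bound`):

`∑_s ‖∑_{n⃗'} [ν ∏ hᵢnᵢ' ≤ Y] 𝔲_{Rd}(ν ∏ hᵢnᵢ' c̄; s)‖ ≤ H^k C L^{C₀} x_F^{1−δ} Φ + (kY/(νH) + 2^k x_F G₀/V_min)(Dv + Φ)
  + Rd² (2^k x_F G₀/V_min) Ψ`.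

* `coreTerm ν Y Rd c s N = [νN ≤ Y] 𝔲_{Rd}(νN c̄; s)`; `coreTerm_mul`;
* `natCast_prod_mul_eq_of_mem` — the class of `ν ∏ hᵢ nᵢ'` mod `L` depends on `(h⃗, t⃗)` only;
* `exists_perm_sorted_sum` — sorting the coordinates and splitting off the last one;
* `good_tuple_bound` — the bound above.

## References

* S. Drappeau, Proc. London Math. Soc. (3) 114 (2017) 684–732, §6.2. [Drappeau2017]
* É. Fouvry, G. Tenenbaum, Trans. Amer. Math. Soc. 375 (2022), Lemmas 4.12–4.13. [FouvryTenenbaum2021]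
-/

open Finset Fintype Real
open scoped ArithmeticFunction.sigma Classical

noncomputable section

namespace Literature.NumberTheory.Sieve

namespace DrappeauTypeI

open Drappeau2017 FouvryTenenbaum2021

/-! ### The summand -/

/-- The summand of the Type I core: `[ν N ≤ Y] 𝔲_{Rd}(ν N c̄; s)`. [cite: Drappeau2017, §6.2] -/
def coreTerm (ν : ℕ) (Y Rd : ℝ) (c : ℤ) (s N : ℕ) : ℂ :=
  if ((ν * N : ℕ) : ℝ) ≤ Y then uR Rd s (((ν * N : ℕ) : ZMod s) * ((c : ZMod s))⁻¹) else 0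

/-- `coreTerm ν (P N) = coreTerm (ν P) N`. [folklore] -/
theorem coreTerm_mul (ν P N : ℕ) (Y Rd : ℝ) (c : ℤ) (s : ℕ) :
    coreTerm ν Y Rd c s (P * N) = coreTerm (ν * P) Y Rd c s N := by
  simp only [coreTerm, mul_assoc]

/-- `‖coreTerm‖ ≤ ‖𝔲_{Rd}(ν N c̄; s)‖`. [folklore] -/
theorem norm_coreTerm_le (ν : ℕ) (Y Rd : ℝ) (c : ℤ) (s N : ℕ) :
    ‖coreTerm ν Y Rd c s N‖ ≤ ‖uR Rd s (((ν * N : ℕ) : ZMod s) * ((c : ZMod s))⁻¹)‖ := by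
  unfold coreTerm
  split_ifs
  · exact le_rfl
  · rw [norm_zero]; exact norm_nonneg _

/-- `ν ∏ (hᵢ nᵢ) = (ν ∏ hᵢ) ∏ nᵢ`. [folklore] -/
theorem mul_prod_mul_eq {k : ℕ} (ν : ℕ) (p : Fin k → ℕ × ℕ) (n : Fin k → ℕ) :
    ν * ∏ i, ((p i).1 * n i) = (ν * ∏ i, (p i).1) * ∏ i, n i := by
  rw [Finset.prod_mul_distrib]; ring

/-- **The class condition depends on the index tuple only**: for `nᵢ' ∈ subBox Vᵢ L (hᵢ, tᵢ)`,
`ν ∏ hᵢ nᵢ' ≡ ν ∏ hᵢ tᵢ (mod L)`. [folklore] -/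
theorem natCast_prod_mul_eq_of_mem {k : ℕ} {L : ℕ} {V : Fin k → ℝ} (hV : ∀ i, 0 ≤ V i) (ν : ℕ)
    {p : Fin k → ℕ × ℕ} {n : Fin k → ℕ} (hn : n ∈ piFinset (fun i => subBox (V i) L (p i))) :
    ((ν * ∏ i, ((p i).1 * n i) : ℕ) : ZMod L) = ((ν * ∏ i, ((p i).1 * (p i).2) : ℕ) : ZMod L) := by
  push_cast
  congr 1
  refine Finset.prod_congr rfl fun i _ => ?_
  rw [((mem_subBox (hV i)).1 (Fintype.mem_piFinset.1 hn i)).2]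

/-- A sum of terms guarded by a CONSTANT condition has norm at most the norm of the unguarded sum. [folklore] -/
theorem norm_sum_ite_const_le {ι : Type*} (S : Finset ι) (P : Prop) [Decidable P] (G : ι → ℂ) :
    ‖∑ x ∈ S, (if P then G x else 0)‖ ≤ ‖∑ x ∈ S, G x‖ := by
  by_cases h : P
  · simp only [if_pos h, le_refl]
  · simp only [if_neg h, Finset.sum_const_zero, norm_zero, norm_nonneg]

/-! ### Sorting the coordinates -/

/-- **Sorting and splitting off the largest scale**: for scales `V' : Fin (k+1) → ℝ` there is a permutation `perm`
with `V' ∘ perm` increasing such that every tuple sum of a function of `∏ nᵢ` over `∏ Bᵢ` equals the iterated sum over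
the first `k` sorted coordinates and then the last one. [folklore] -/
theorem exists_perm_sorted_sum {k : ℕ} (V' : Fin (k + 1) → ℝ) (B : Fin (k + 1) → Finset ℕ) :
    ∃ perm : Equiv.Perm (Fin (k + 1)), Monotone (V' ∘ perm) ∧ ∀ G : ℕ → ℂ,
      ∑ n ∈ piFinset B, G (∏ i, n i) =
        ∑ g ∈ piFinset (fun i : Fin k => B (perm (Fin.castSucc i))), ∑ a ∈ B (perm (Fin.last k)), G ((∏ i, g i) * a) := by
  refine ⟨Tuple.sort V', Tuple.monotone_sort V', fun G => ?_⟩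
  rw [TupleSums.sum_piFinset_perm (Tuple.sort V') B (fun n => G (∏ i, n i))]
  have h1 : ∀ f : Fin (k + 1) → ℕ, (∏ i, f ((Tuple.sort V').symm i)) = ∏ i, f i :=
    fun f => Equiv.prod_comp (Tuple.sort V').symm f
  simp_rw [h1]
  rw [TupleSums.sum_piFinset_succ_last (fun i => B (Tuple.sort V' i)) (fun n => G (∏ i, n i))]
  refine Finset.sum_congr rfl fun g _ => Finset.sum_congr rfl fun a _ => ?_
  rw [Fin.prod_snoc]

/-- `∏_{i<k} 2Wᵢ ≤ 2^k x_F G₀ / V_min` when `(∏_{i<k} Wᵢ) W_l ≤ x_F` and `W_l ≥ V_min/G₀ > 0`. [folklore] -/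
theorem prod_init_le {k : ℕ} {W : Fin k → ℝ} {Wl xF Vmin G₀ : ℝ} (hW : ∀ i, 0 ≤ W i) (hVmin : 0 < Vmin)
    (hG₀ : 0 < G₀) (hWl : Vmin / G₀ ≤ Wl) (hprod : (∏ i, W i) * Wl ≤ xF) :
    ∏ i, (2 * W i) ≤ 2 ^ k * xF * G₀ / Vmin := by
  have hWl0 : 0 < Wl := lt_of_lt_of_le (div_pos hVmin hG₀) hWl
  have hP0 : 0 ≤ ∏ i, W i := Finset.prod_nonneg fun i _ => hW i
  have h1 : ∏ i, W i ≤ xF / Wl := by rw [le_div_iff₀ hWl0]; exact hprod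
  have h2 : xF / Wl ≤ xF * G₀ / Vmin := by
    have hxF : 0 ≤ xF := le_trans (mul_nonneg hP0 hWl0.le) hprod
    rw [div_le_div_iff₀ hWl0 hVmin]
    calc xF * Vmin = xF * (Vmin / G₀ * G₀) := by field_simp
      _ ≤ xF * (Wl * G₀) := by gcongr
      _ = xF * G₀ * Wl := by ring
  rw [Finset.prod_mul_distrib, Finset.prod_const, Finset.card_univ, Fintype.card_fin]
  calc (2 : ℝ) ^ k * ∏ i, W i ≤ 2 ^ k * (xF * G₀ / Vmin) :=
        mul_le_mul_of_nonneg_left (h1.trans h2) (by positivity)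
    _ = 2 ^ k * xF * G₀ / Vmin := by ring

/-! ### One good index tuple -/

/-- **The Type I bound for one good index tuple** `p = (hᵢ, tᵢ)ᵢ` (all `hᵢ ≤ G₀`): the hypotheses are those of the
core estimate (unsorted scales `Vᵢ ≥ max(x_F^{1/100}, |c|) G₀`, `Vᵢ ≥ V_min > 0`, `∏ Vᵢ ≤ x_F`, moduli `s ≤ x_F^θ`
coprime to `cL`, a divisor-count bound `Dv` valid up to `|z| ≤ Z`, `Z ≥ 2^{k+2} ν G₀^{k+1} x_F`), and the bound is
`H^k C L^{C₀} x_F^{1−δ} Φ + (kY/(νH) + 2^k x_F G₀/V_min)(Dv + Φ) + Rd² (2^k x_F G₀/V_min) Ψ`. [cite: Drappeau2017, §6.2] -/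
theorem good_tuple_bound {k : ℕ} {θ δ C₀ C : ℝ}
    (hFT : ∀ x : ℝ, 1 ≤ x → ∀ (M lo hi : Fin k → ℝ) (Ml lol hil : ℝ), Monotone M → (∀ i, M i ≤ Ml) →
      (∀ i, x ^ (1 / 100 : ℝ) ≤ M i) → x ^ (1 / 100 : ℝ) ≤ Ml → (∏ i, M i) * Ml ≤ x →
      (∀ i, M i ≤ lo i) → (∀ i, hi i ≤ 2 * M i) → Ml ≤ lol → hil ≤ 2 * Ml →
      ∀ (s D : ℕ) (a : ℤ) (t : Fin k → ℤ) (tl : ℤ), 1 ≤ s → (s : ℝ) ≤ x ^ θ → 1 ≤ D →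
      IsCoprime (s : ℤ) (a * D) → (∀ i, IsCoprime (t i) (D : ℤ)) → IsCoprime tl (D : ℤ) →
      |∑ m ∈ piFinset (fun i => apBox (lo i) (hi i) D (t i)), ∑ n ∈ apBox lol hil D tl,
          gAP s a ((∏ i, m i) * n)| ≤ C * (D : ℝ) ^ C₀ * x ^ (1 - δ) / (Nat.totient s : ℝ))
    (hC : 0 ≤ C) {xF : ℝ} (hxF : 1 ≤ xF) {V : Fin (k + 1) → ℝ} {Vmin : ℝ} (hVmin : 0 < Vmin)
    (hVminV : ∀ i, Vmin ≤ V i) {G₀ : ℕ} (hG₀ : 1 ≤ G₀) (hV1 : ∀ i, xF ^ (1 / 100 : ℝ) * G₀ ≤ V i)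
    {c : ℤ} (hcV : ∀ i, (|c| : ℝ) * G₀ ≤ V i) (hprod : ∏ i, V i ≤ xF) {L : ℕ} (hL : 1 ≤ L)
    {ν : ℕ} (hν : 1 ≤ ν) {Y : ℝ} (hY : 0 ≤ Y) {H : ℕ} (hH : 1 ≤ H) {Rd : ℝ} (hRd : 1 ≤ Rd) (𝒮 : Finset ℕ)
    (h𝒮 : ∀ s ∈ 𝒮, 1 ≤ s ∧ s.Coprime L ∧ IsCoprime (s : ℤ) c ∧ (s : ℝ) ≤ xF ^ θ)
    {Z Dv : ℝ} (hZ : (2 : ℝ) ^ (k + 2) * ν * (G₀ : ℝ) ^ (k + 1) * xF ≤ Z)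
    (hDv : ∀ z : ℤ, z ≠ 0 → (|z| : ℝ) ≤ Z → ((𝒮.filter (fun s : ℕ => (s : ℤ) ∣ z)).card : ℝ) ≤ Dv)
    {p : Fin (k + 1) → ℕ × ℕ} (hp : p ∈ piFinset (fun i => idx L ⌊2 * V i⌋₊)) (hgood : ∀ i, (p i).1 ≤ G₀) :
    ∑ s ∈ 𝒮, ‖∑ n ∈ piFinset (fun i => subBox (V i) L (p i)), coreTerm ν Y Rd c s (∏ i, ((p i).1 * n i))‖ ≤
      (H : ℝ) ^ k * (C * (L : ℝ) ^ C₀ * xF ^ (1 - δ)) * ∑ s ∈ 𝒮, ((Nat.totient s : ℝ))⁻¹ +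
        ((k : ℝ) * Y / (ν * H) + 2 ^ k * xF * G₀ / Vmin) * (Dv + ∑ s ∈ 𝒮, ((Nat.totient s : ℝ))⁻¹) +
        Rd ^ 2 * (2 ^ k * xF * G₀ / Vmin) * ∑ s ∈ 𝒮, (σ 0 s : ℝ) ^ 2 / (Nat.totient s : ℝ) := by
  -- the index tuple
  have hpi : ∀ i, (1 ≤ (p i).1 ∧ (p i).1 ≤ ⌊2 * V i⌋₊) ∧ (p i).2 < L ∧ (p i).2.Coprime L := by
    intro i
    have h := Fintype.mem_piFinset.1 hp i
    simp only [idx, Finset.mem_product, mem_smoothBelow, mem_unitReps] at h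
    exact ⟨h.1.1, h.2⟩
  have hh1 : ∀ i, (1 : ℝ) ≤ (p i).1 := fun i => by exact_mod_cast (hpi i).1.1
  have hh0 : ∀ i, (0 : ℝ) < (p i).1 := fun i => lt_of_lt_of_le one_pos (hh1 i)
  have hhG : ∀ i, ((p i).1 : ℝ) ≤ G₀ := fun i => by exact_mod_cast hgood i
  have hG₀' : (1 : ℝ) ≤ G₀ := by exact_mod_cast hG₀
  have hG₀0 : (0 : ℝ) < G₀ := by linarith
  have hV0 : ∀ i, 0 < V i := fun i => lt_of_lt_of_le hVmin (hVminV i)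
  -- reduced scales
  set V' : Fin (k + 1) → ℝ := fun i => V i / (p i).1 with hV'
  have hV'le : ∀ i, V' i ≤ V i := fun i => div_le_self (hV0 i).le (hh1 i)
  have hV'ge : ∀ i, V i / G₀ ≤ V' i := fun i => div_le_div_of_nonneg_left (hV0 i).le (hh0 i) (hhG i)
  have hV'0 : ∀ i, 0 < V' i := fun i => div_pos (hV0 i) (hh0 i)
  have hV'1 : ∀ i, xF ^ (1 / 100 : ℝ) ≤ V' i := fun i =>
    le_trans (by rw [le_div_iff₀ hG₀0]; exact hV1 i) (hV'ge i)
  have hV'c : ∀ i, (|c| : ℝ) ≤ V' i := fun i => le_trans (by rw [le_div_iff₀ hG₀0]; exact hcV i) (hV'ge i)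
  have hV'min : ∀ i, Vmin / G₀ ≤ V' i := fun i =>
    le_trans (div_le_div_of_nonneg_right (hVminV i) hG₀0.le) (hV'ge i)
  -- `ν' = ν ∏ hᵢ`
  set ν' : ℕ := ν * ∏ i, (p i).1 with hν'
  have hP1 : 1 ≤ ∏ i, (p i).1 := Finset.one_le_prod' fun i _ => (hpi i).1.1
  have hν'1 : 1 ≤ ν' := Nat.one_le_iff_ne_zero.2 (Nat.mul_ne_zero (by omega) (by omega))
  have hνν' : (ν : ℝ) ≤ ν' := by rw [hν']; exact_mod_cast Nat.le_mul_of_pos_right ν hP1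
  have hν'le : (ν' : ℝ) ≤ ν * (G₀ : ℝ) ^ (k + 1) := by
    rw [hν']; push_cast
    refine mul_le_mul_of_nonneg_left ?_ (Nat.cast_nonneg _)
    calc ∏ i, ((p i).1 : ℝ) ≤ ∏ _i : Fin (k + 1), (G₀ : ℝ) := Finset.prod_le_prod (fun i _ => (hh0 i).le) fun i _ => hhG i
      _ = (G₀ : ℝ) ^ (k + 1) := by rw [Finset.prod_const, Finset.card_univ, Fintype.card_fin]
  -- rewrite the summand through `ν'` and sort
  have hterm : ∀ s, ∀ n : Fin (k + 1) → ℕ, coreTerm ν Y Rd c s (∏ i, ((p i).1 * n i)) =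
      coreTerm ν' Y Rd c s (∏ i, n i) := by
    intro s n
    rw [Finset.prod_mul_distrib, coreTerm_mul]
  obtain ⟨perm, hpmono, hpsum⟩ := exists_perm_sorted_sum V' (fun i => subBox (V i) L (p i))
  have hrew : ∀ s, ∑ n ∈ piFinset (fun i => subBox (V i) L (p i)), coreTerm ν Y Rd c s (∏ i, ((p i).1 * n i)) =
      ∑ g ∈ piFinset (fun i : Fin k => subBox (V (perm (Fin.castSucc i))) L (p (perm (Fin.castSucc i)))),
        ∑ a ∈ subBox (V (perm (Fin.last k))) L (p (perm (Fin.last k))), coreTerm ν' Y Rd c s ((∏ i, g i) * a) := by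
    intro s
    rw [Finset.sum_congr rfl fun n _ => hterm s n]
    exact hpsum (coreTerm ν' Y Rd c s)
  rw [Finset.sum_congr rfl fun s _ => congrArg (fun z => ‖z‖) (hrew s)]
  -- the sorted data
  set W : Fin k → ℝ := fun i => V' (perm (Fin.castSucc i)) with hW
  set Wl : ℝ := V' (perm (Fin.last k)) with hWl
  have hWmono : Monotone W := fun i j hij => hpmono (Fin.strictMono_castSucc.monotone hij)
  have hWWl : ∀ i, W i ≤ Wl := fun i => hpmono (Fin.castSucc_lt_last i).le
  have hWprod : (∏ i, W i) * Wl ≤ xF := by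
    have h1 : (∏ i, W i) * Wl = ∏ i, V' (perm i) := by rw [Fin.prod_univ_castSucc]
    rw [h1, Equiv.prod_comp perm V']
    exact le_trans (Finset.prod_le_prod (fun i _ => (hV'0 i).le) fun i _ => hV'le i) hprod
  have ht : ∀ i : Fin k, IsCoprime (((p (perm (Fin.castSucc i))).2 : ℕ) : ℤ) (L : ℤ) := fun i =>
    Nat.isCoprime_iff_coprime.2 (hpi _).2.2
  have htl : IsCoprime (((p (perm (Fin.last k))).2 : ℕ) : ℤ) (L : ℤ) := Nat.isCoprime_iff_coprime.2 (hpi _).2.2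
  have hDv' : ∀ z : ℤ, z ≠ 0 → (|z| : ℝ) ≤ 2 ^ (k + 2) * ν' * xF →
      ((𝒮.filter (fun s : ℕ => (s : ℤ) ∣ z)).card : ℝ) ≤ Dv := by
    intro z hz hzle
    refine hDv z hz (hzle.trans (le_trans ?_ hZ))
    have : (0 : ℝ) ≤ xF := by linarith
    calc (2 : ℝ) ^ (k + 2) * ν' * xF ≤ 2 ^ (k + 2) * (ν * (G₀ : ℝ) ^ (k + 1)) * xF := by gcongr
      _ = 2 ^ (k + 2) * ν * (G₀ : ℝ) ^ (k + 1) * xF := by ring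
  have key := typeI_uR_bound hFT hC hxF hWmono hWWl (fun i => hV'1 _) (hV'1 _) hWprod hL ht htl
    (hV'c _) hν'1 hY hH hRd 𝒮 h𝒮 hDv'
  -- `key` is stated for `apBox (W i) (2 * W i)`; our boxes are these by definition
  have hbox : ∀ j, subBox (V j) L (p j) = apBox (V' j) (2 * V' j) L ((p j).2 : ℤ) := fun j => rfl
  simp only [hbox] at key ⊢
  refine (key.trans ?_)
  -- compare the three terms
  have hΦ0 : 0 ≤ ∑ s ∈ 𝒮, ((Nat.totient s : ℝ))⁻¹ := Finset.sum_nonneg fun _ _ => inv_nonneg.2 (Nat.cast_nonneg _)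
  have hΨ0 : 0 ≤ ∑ s ∈ 𝒮, (σ 0 s : ℝ) ^ 2 / (Nat.totient s : ℝ) := Finset.sum_nonneg fun _ _ => by positivity
  have hDv0 : 0 ≤ Dv := le_trans (Nat.cast_nonneg _) (hDv' 1 one_ne_zero (by
    simp only [Int.cast_one, abs_one]
    have h2 : (1 : ℝ) ≤ 2 ^ (k + 2) := one_le_pow₀ (by norm_num)
    have h3 : (1 : ℝ) ≤ ν' := by exact_mod_cast hν'1
    have h4 : (1 : ℝ) ≤ 2 ^ (k + 2) * ν' := one_le_mul_of_one_le_of_one_le h2 h3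
    nlinarith))
  have hWinit : ∏ i, (2 * W i) ≤ 2 ^ k * xF * G₀ / Vmin :=
    prod_init_le (fun i => (hV'0 _).le) hVmin hG₀0 (hV'min _) hWprod
  have hYterm : (k : ℝ) * Y / (ν' * H) ≤ (k : ℝ) * Y / (ν * H) := by
    have hν0 : (0 : ℝ) < ν := by exact_mod_cast hν
    have hH0 : (0 : ℝ) < H := by exact_mod_cast hH
    apply div_le_div_of_nonneg_left (by positivity) (by positivity)
    exact mul_le_mul_of_nonneg_right hνν' hH0.le
  have hW0 : 0 ≤ ∏ i, (2 * W i) := Finset.prod_nonneg fun i _ => by linarith [(hV'0 (perm (Fin.castSucc i))).le]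
  gcongr

end DrappeauTypeI

end Literature.NumberTheory.Sieve

end
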